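import Literature.AlgebraicGeometry.AbelianSchemes.AbelianSchemeQuotientPolarizationPullbackOfReduced
import Literature.AlgebraicGeometry.AbelianSchemes.PolarizationUnitHypothesis
import Literature.AlgebraicGeometry.AbelianSchemes.PolarizationHasTypeOfDualIsogeny
import Literature.AlgebraicGeometry.AbelianSchemes.SymplecticLiftOfIsogenyQuotient
import Literature.AlgebraicGeometry.AbelianSchemes.FibreHomPointsOfFibrePoints
import Literature.AlgebraicGeometry.AbelianSchemes.AbelianSchemeDualIsogenyHom
import Literature.AlgebraicGeometry.Motives.AlgPointsMapSurjectiveAlgClosed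
import HarnessLib

/-!
# The `hasType` field of the Hecke quotient triple — `HasType δ` for ANY polarisation structure on the descended `λ_B`

Topic `AlgebraicGeometry/AbelianSchemes`; namespace `Literature.AlgebraicGeometry.AbelianSchemes.AbelianSchemeOver`.
THEOREMS ONLY (no definition, no named fact, no instance, no notation, no `sorry`; net Literature debt 0).  Cell
hodgecm-mathlib (D-0151), HECKE-LINK line, socket (B): the `htype` COMPONENT of the external package `hExt` of ★-to-be
`SiegelHeckeQuotientTripleGlue.exists_heckeQuotientTriple_of_ext` (B-p21 (g14)) / the `htype` binder of ★ `HeckeQuotientTriple`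
(`exists_quotientTriple_of_fields`), B-plan1 (g15) 00:10:10Z (3).  In the (ii)-chain data block of ★ `HeckeQuotientTriple`
(quotient `ψ : A → A/K`, dual side `Â → Â/K′`, equivariant structure `Φ`, universality `h4`, a polarisation `pol` of
`(A, D)` with `hlam`), for ANY polarisation structure `polB` of `(A/K, D_B)` whose homomorphism is the descended one
(`hpolB : polB.lam = polarizationDesc …`):

  `pol.HasType δ`, `Nat.Coprime n (∏ δᵢ)` (socket (B) text v8), `(n : Ω) ≠ 0`, `λ_B` onto on geometric points, and the
  per-point KERNEL COUNT `|ker ψ_s| · |ker ψ^∨_s| = |A_s[n]|`  ⟹  `polB.HasType δ`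

(`Polarization.hasType_polarizationDesc_of_count`).  Everything else is discharged here from ★: the descended-polarisation
identity `ψ ≫ λ_B ≫ ψ^∨ = λ ^ n` (★ `quotientMk_comp_polarizationDesc_comp_dualIsogeny_of_isReduced` + ★
`comp_comp_dualIsogenyOver_eq_pow_of_left`), `ψ^∨` a homomorphism (★ `DualPair.isMonHom_dualIsogenyOver`, unit normalisations
from the two polarisations), `ψ_s` onto (★ `quotientBy_ontoFibres` + ★ `surjective_map_fibreHom_of_forall_fibrePoints`),
`n`-divisibility and `|A_s[n]| = n^{2 dim}` (★ `pow_surjective_of_isAlgClosed`, ★ `natCard_ker_powMonoidHom_eq`), and the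
finite-group transport ★ `Polarization.hasType_of_fibreIsogeny_of_dualIsogeny_of_coprime`.  The count binder is the
(SYM-n)/(K) bookkeeping `|K| = |K′| = n^g` of the Hecke kernel (owners B-p05/B-p09/B-p08); `hlamB` is «a polarisation is onto
on geometric points» (B-p02 (D1)/(D2), ★ `Polarization.surjective_lam_left` road).  HC_CM is proved only modulo the 7
printed citations until rung 0 closes; this file discharges none of them.

## References
* [MumfordAV1970] D. Mumford, *Abelian Varieties* (1970), §7 Thm. 4 (p. 72), §15 Thm. 1 (p. 143), §23 Thm. 2 (p. 231).
* [MumfordFogartyKirwan1994] D. Mumford, J. Fogarty, F. Kirwan, *Geometric Invariant Theory*, 3rd ed. (1994), App. 7A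
  (pp. 234–235), Ch. 7 §3 (p. 139).
-/

set_option autoImplicit false

noncomputable section

universe u

open CategoryTheory CategoryTheory.Limits AlgebraicGeometry

open scoped MonObj

namespace Literature.AlgebraicGeometry.AbelianSchemes

namespace AbelianSchemeOver

open Literature.AlgebraicGeometry.RelativeSpec Literature.AlgebraicGeometry.AbelianVarieties
  Literature.AlgebraicGeometry.Motives Literature.AlgebraicGeometry.Modules

variable {S : Scheme.{u}} [IsReduced S] [IsLocallyNoetherian S] (A : AbelianSchemeOver S)
  {Y : Scheme.{u}} (u : S ⟶ Y) (K : Subgroup A.Sections) [IsCommMonObj A.X] {n : ℕ}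
  (hK : ∀ σ : K, (σ : A.Sections) ^ n = 1)
  [Finite K] [Y.IsSeparated] [IsSeparated (A.X.hom ≫ u)] [S.IsSeparated]
  (hcov : ∀ x : A.left, ∃ O : (A.translationActionOver u K).StableAffineOpens, x ∈ O.1)
  [LocallyOfFiniteType (A.X.hom ≫ u)] [IsLocallyNoetherian Y]
  (hG : ∃ _ : GrpObj (A.quotientOver u K), IsMonHom (A.quotientMk u K hcov))
  (hsm : Smooth (A.quotientOver u K).hom) (hgc : GeometricallyConnected (A.quotientOver u K).hom)
  (D : A.DualPair) [IsAffine Y]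
  (hfree : ∀ (Ω : Type u) [Field Ω] [IsAlgClosed Ω] (x : Spec (.of Ω) ⟶ A.left) (σ : K), σ ≠ 1 →
    x ≫ (A.translation (σ : A.Sections)).left ≠ x)
  (K' : Subgroup D.hat.Sections) [Finite K'] [IsSeparated (D.hat.X.hom ≫ u)]
  (hcov' : ∀ x : D.hat.left, ∃ O : (D.hat.translationActionOver u K').StableAffineOpens, x ∈ O.1)
  [LocallyOfFiniteType (D.hat.X.hom ≫ u)]
  (hG' : ∃ _ : GrpObj (D.hat.quotientOver u K'), IsMonHom (D.hat.quotientMk u K' hcov'))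
  (hsm' : Smooth (D.hat.quotientOver u K').hom) (hgc' : GeometricallyConnected (D.hat.quotientOver u K').hom)
  (hfree' : ∀ (Ω : Type u) [Field Ω] [IsAlgClosed Ω] (x : Spec (.of Ω) ⟶ D.hat.left) (σ : K'), σ ≠ 1 →
    x ≫ (D.hat.translation (σ : D.hat.Sections)).left ≠ x)
  (Φ : (prodTranslationActionOver (A.quotientBy u K hcov hG hsm hgc) D.hat u K' hcov').EquivariantStructure
    (A.poincarePullback u K hK hcov hG hsm hgc D hfree))

/-- **THE `hasType` FIELD OF THE HECKE QUOTIENT TRIPLE.**  For ANY polarisation structure `polB` of `(A/K, D_B)` on the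
descended homomorphism `λ_B = polarizationDesc λ` (`hpolB`): `pol.HasType δ` transports to `polB.HasType δ` given the socket's
coprimality `Nat.Coprime n (∏ δᵢ)`, invertibility of `n` at every geometric point, `λ_B` onto on geometric points, and the
kernel count `|ker ψ_s| · |ker ψ^∨_s| = |A_s[n]|` (finite kernels).  All other inputs of ★
`Polarization.hasType_of_fibreIsogeny_of_dualIsogeny_of_coprime` are discharged from the (ii)-chain ★.
[cite: MumfordAV1970, §23 Thm. 2 (p. 231) and §7 Thm. 4 (p. 72)] [cite: MumfordFogartyKirwan1994, App. 7A (pp. 234–235)] -/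
theorem Polarization.hasType_polarizationDesc_of_count
    (h4 : ∀ {T : Scheme.{u}} (f : T ⟶ S) (ℒ : (A.quotientBy u K hcov hG hsm hgc).RigidifiedLineBundle f),
      ℒ.FibrewisePicZero →
      ∃! g : {g : T ⟶ (D.hat.quotientBy u K' hcov' hG' hsm' hgc').X.left //
          g ≫ (D.hat.quotientBy u K' hcov' hG' hsm' hgc').X.hom = f},
        Nonempty ((Scheme.Modules.pullback ((A.quotientBy u K hcov hG hsm hgc).baseChangeToProd
          (D.hat.quotientBy u K' hcov' hG' hsm' hgc') f g.1 g.2)).obj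
            (A.poincareQuotRigid u K hK hcov hG hsm hgc D hfree K' hcov' hG' hsm' hgc' Φ) ≅ ℒ.L))
    (pol : A.Polarization D)
    (hlam : ∀ σ : K, A.translation (σ : A.Sections) ≫ pol.lam ≫ D.hat.quotientMk u K' hcov' =
      pol.lam ≫ D.hat.quotientMk u K' hcov')
    (polB : (A.quotientBy u K hcov hG hsm hgc).Polarization
      (A.dualPairOfQuotientRigidified u K hK hcov hG hsm hgc D hfree K' hcov' hG' hsm' hgc' hfree' Φ h4))
    (hpolB : polB.lam = A.polarizationDesc u K hcov D.hat K' hcov' pol.lam hlam)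
    {g : ℕ} {δ : Fin g → ℕ} (hT : pol.HasType δ) (hcop : Nat.Coprime n (∏ i, δ i))
    (hn : ∀ (Ω : Type u) [Field Ω] [IsAlgClosed Ω] (_ : Spec (.of Ω) ⟶ S), (n : Ω) ≠ 0)
    (hlamB : ∀ (Ω : Type u) [Field Ω] [IsAlgClosed Ω] (s : Spec (.of Ω) ⟶ S),
      haveI := polB.isMonHom
      Function.Surjective (AlgPoints.map (L := Ω) (fibreHom polB.lam s).hom.hom.hom))
    (hcount : ∀ (Ω : Type u) [Field Ω] [IsAlgClosed Ω] (s : Spec (.of Ω) ⟶ S),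
      letI : GrpObj (A.quotientOver u K) := (A.quotientBy u K hcov hG hsm hgc).grpObj
      haveI : @IsMonHom _ _ _ A.X (A.quotientBy u K hcov hG hsm hgc).X _ _ (A.quotientMk u K hcov) :=
        A.isMonHom_quotientMk u K hcov hG hsm hgc
      haveI := polB.isMonHom
      haveI := pol.isMonHom
      haveI : IsMonHom (DualPair.dualIsogenyOver
          (show A.X ⟶ (A.quotientBy u K hcov hG hsm hgc).X from A.quotientMk u K hcov) D
          (A.dualPairOfQuotientRigidified u K hK hcov hG hsm hgc D hfree K' hcov' hG' hsm' hgc' hfree' Φ h4)) :=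
        DualPair.isMonHom_dualIsogenyOver _ D _ polB.nonempty_unitHatSlice_iso pol.nonempty_unitHatSlice_iso
      Finite (IsMonHom.monoidHom (fibreHom
          (show A.X ⟶ (A.quotientBy u K hcov hG hsm hgc).X from A.quotientMk u K hcov) s).hom.hom.hom
          (specOver Ω Ω)).ker ∧
      Finite (IsMonHom.monoidHom (fibreHom (DualPair.dualIsogenyOver
          (show A.X ⟶ (A.quotientBy u K hcov hG hsm hgc).X from A.quotientMk u K hcov) D
          (A.dualPairOfQuotientRigidified u K hK hcov hG hsm hgc D hfree K' hcov' hG' hsm' hgc' hfree' Φ h4)) s).hom.hom.hom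
          (specOver Ω Ω)).ker ∧
      Nat.card (IsMonHom.monoidHom (fibreHom
          (show A.X ⟶ (A.quotientBy u K hcov hG hsm hgc).X from A.quotientMk u K hcov) s).hom.hom.hom
          (specOver Ω Ω)).ker *
        Nat.card (IsMonHom.monoidHom (fibreHom (DualPair.dualIsogenyOver
          (show A.X ⟶ (A.quotientBy u K hcov hG hsm hgc).X from A.quotientMk u K hcov) D
          (A.dualPairOfQuotientRigidified u K hK hcov hG hsm hgc D hfree K' hcov' hG' hsm' hgc' hfree' Φ h4)) s).hom.hom.hom
          (specOver Ω Ω)).ker =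
        Nat.card (powMonoidHom n : (A.fibre s).toAbelianVariety.Points Ω →* _).ker) :
    polB.HasType δ := by
  letI : GrpObj (A.quotientOver u K) := (A.quotientBy u K hcov hG hsm hgc).grpObj
  haveI hψ := A.isMonHom_quotientMk u K hcov hG hsm hgc
  haveI hψ' : @IsMonHom _ _ _ A.X (A.quotientBy u K hcov hG hsm hgc).X _ _ (A.quotientMk u K hcov) := hψ
  haveI := polB.isMonHom
  haveI := pol.isMonHom
  haveI hmon : IsMonHom (DualPair.dualIsogenyOver
      (show A.X ⟶ (A.quotientBy u K hcov hG hsm hgc).X from A.quotientMk u K hcov) D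
      (A.dualPairOfQuotientRigidified u K hK hcov hG hsm hgc D hfree K' hcov' hG' hsm' hgc' hfree' Φ h4)) :=
    DualPair.isMonHom_dualIsogenyOver _ D _ polB.nonempty_unitHatSlice_iso pol.nonempty_unitHatSlice_iso
  -- export (b), `.left` form, then as `ψ ≫ λ_B ≫ ψ^∨ = λ ^ n`
  have hb0 := A.quotientMk_comp_polarizationDesc_comp_dualIsogeny_of_isReduced u K hK hcov hG hsm hgc D hfree K' hcov'
    hG' hsm' hgc' hfree' Φ h4 pol.nonempty_unitHatSlice_iso pol.lam hlam
  rw [← hpolB] at hb0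
  have hb : (show A.X ⟶ (A.quotientBy u K hcov hG hsm hgc).X from A.quotientMk u K hcov) ≫ polB.lam ≫
      DualPair.dualIsogenyOver (show A.X ⟶ (A.quotientBy u K hcov hG hsm hgc).X from A.quotientMk u K hcov) D
        (A.dualPairOfQuotientRigidified u K hK hcov hG hsm hgc D hfree K' hcov' hG' hsm' hgc' hfree' Φ h4) =
      pol.lam ^ n :=
    comp_comp_dualIsogenyOver_eq_pow_of_left _ pol.lam polB.lam n hb0
  refine Polarization.hasType_of_fibreIsogeny_of_dualIsogeny_of_coprime pol polB
    (show A.X ⟶ (A.quotientBy u K hcov hG hsm hgc).X from A.quotientMk u K hcov) n hb hT hcop ?_ hlamB ?_ ?_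
  · -- `ψ_s` onto on `Ω`-points (★ (i) + the `FibrePoints → AlgPoints` bridge)
    intro Ω _ _ s
    exact surjective_map_fibreHom_of_forall_fibrePoints s _ (fun y => A.quotientBy_ontoFibres u K hcov hG hsm hgc s y)
  · -- `n`-divisibility of `A_s(Ω)`
    intro Ω _ _ s
    exact AbelianVariety.pow_surjective_of_isAlgClosed (A.fibre s).toAbelianVariety n (hn Ω s)
  · -- the count, and `|A_s[n](Ω)| = n ^ (2 dim)`
    intro Ω _ _ s
    obtain ⟨hfin, hfind, hprod⟩ := hcount Ω s
    exact ⟨hfin, hfind, hprod.symm, _,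
      AbelianVariety.natCard_ker_powMonoidHom_eq (A.fibre s).toAbelianVariety Ω n (hn Ω s)⟩

end AbelianSchemeOver

end Literature.AlgebraicGeometry.AbelianSchemes

end
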